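import Literature.MathematicalPhysics.QuantumLattice.LTQO
import Literature.MathematicalPhysics.QuantumLattice.ProductOperators
import Literature.MathematicalPhysics.QuantumLattice.SpinSystemProofs
import HarnessLib

/-!
# The `ℤ₂` gauge–Higgs model on the torus in unitary gauge (toric code in fields)

Trunk T-QLATTICE (family `hubbard`; the "toric-code anchor" of route `EatTheGoldstone`, support
item `ToricCodeAnchor`, and the `κ → ∞` / unitary-gauge end of `gaugedHubbardTorus`). The
two-dimensional `ℤ₂` lattice gauge theory with Ising matter in UNITARY gauge, Fradkin (2013) §9.10,
eq. (9.76):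

`H = -g Σ_b σˣ_b - (1/g) Σ_p Π_{b ∈ ∂p} σᶻ_b - (1/λ) Σ_x Π_{b ∋ x} σˣ_b - λ Σ_b σᶻ_b`,

the Kitaev toric code (Kitaev 2003; the `g, λ → 0` limit keeps the second and third terms,
Fradkin loc. cit.) perturbed by the two single-link fields — Hansson–Oganesyan–Sondhi (2004) §5.1,
eq. (zz-h) (`H = K Σ_p Π σᶻ + Γ Σ σˣ`) and §5.2 (Fradkin–Shenker: the charge-2 compact `U(1)` Higgs
model reduces to it). It is written as `Interaction`s on the LINK spin system
`Op (TorusSite 2 L × Fin 2) 2` — the decorated torus `(ℤ/Lℤ)² × κ` with unit cell `κ = Fin 2`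
(link `(x, i)` = the bond from `x` to `x + eᵢ`), local dimension `2` — so that the vocabulary of
`LTQO.lean` (`HasLTQO`, `HasLocalGap`, `localGroundProj`) and the stability fact
`michalakis_zwolak` apply VERBATIM (`d = 2`, `κ = Fin 2`, `q = 2`):

* `sigmaX L b`, `sigmaZ L b` (Pauli matrices `spinHalfPauli 0 / 2` placed on the link `b`);
* `plaquetteLinks L x = {(x,0), (x+e₀,1), (x+e₁,0), (x,1)}`, `starLinks L x = {(x,0), (x,1),
  (x-e₀,0), (x-e₁,1)}`; `plaquetteOp L x = B_p = Π_{∂p} σᶻ`, `starOp L x = A_x = Π_{b ∋ x} σˣ`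
  (product operators, `productOp`);
* `toricCode L : Interaction _ 2`, the commuting-PROJECTOR normal form consumed by
  Michalakis–Zwolak: `Φ (∂p) = ½ (1 - B_p)`, `Φ (star x) = ½ (1 - A_x)`, `0` on other regions;
* `linkFields L Γ μ : Interaction _ 2`, `Φ {b} = -Γ σˣ_b - μ σᶻ_b`;
* `z2GaugeHiggs L K J Γ μ = K • plaquette projectors + J • star projectors + linkFields Γ μ`;
  Fradkin's (9.76) is `K = 2/g`, `J = 2/λ`, `Γ = g`, `μ = λ` up to the additive constant
  `-(1/g) L² - (1/λ) L²` (`-(1/g) B_p = (2/g) · ½(1 - B_p) - 1/g`).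

API proved: `σ² = 1` and hermiticity for the link Paulis, `B_p² = 1`, `A_x² = 1`, `B_p`, `A_x`
Hermitian, hence the toric-code terms `½(1 - B_p)`, `½(1 - A_x)` are Hermitian idempotents
(`half_one_sub_isIdempotent`); supports: `B_p ∈ 𝔄_{∂p}`, `A_x ∈ 𝔄_{star x}`
(`isSupportedOn_plaquetteOp`, `isSupportedOn_starOp`).

## What is NOT here (theorems for provers, not definitions)

`[A_x, B_p] = 0`; frustration-freeness and the `4`-fold ground space of `toricCode L` on the torus
(Kitaev 2003 §2); `IsProjectorInteraction (toricCode L)` for `L ≥ 3` (needs pairwise distinctness of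
the plaquette / star link sets, false for `L ≤ 2` where they coincide); the Gauss-law form with
explicit Ising matter (Fradkin (9.72)–(9.73)) — unitary gauge (9.75) removes the matter field and
the constraint, which is why the anchor is an unconstrained spin model.

## Sources

E. Fradkin, *Field Theories of Condensed Matter Physics* (2nd ed., CUP 2013) §9.10, eqs.
(9.72)–(9.77); A. Yu. Kitaev, Ann. Phys. 303 (2003) 2, §2; T. H. Hansson, V. Oganesyan,
S. L. Sondhi, Ann. Phys. 313 (2004) 497, §5.1–5.2; E. Fradkin, S. Shenker, PRD 19 (1979) 3682;
S. Michalakis, J. Zwolak, CMP 322 (2013) 277.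

## Mathlib / tree search

Tree: `spinHalfPauli` (`SpinOperators`), `Op`/`onSite`/`productOp` (`SpinSystem`,
`ProductOperators`), `Interaction`/`IsProjectorInteraction`/`localHamiltonian` (`LocalDynamics`),
`HasLTQO`/`michalakis_zwolak` (`LTQO`, `LiebRobinson`) are reused; no toric code in the tree
(`rg -i toric`: prose only, `HubbardSpinLiquid`). Mathlib: `Matrix.IsHermitian`, `IsIdempotentElem`.
-/

noncomputable section

namespace Literature.MathematicalPhysics.QuantumLattice

open Matrix Finset Literature.Probability.LatticeModels

namespace Z2GaugeHiggs

/-! ### Link Paulis -/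

/-- The links of the square torus `(ℤ/Lℤ)²`: `(x, i)` is the bond from `x` to `x + eᵢ`; as a
decorated torus this is `TorusSite 2 L × κ` with unit cell `κ = Fin 2`. Fradkin (2013) §9.6.
[folklore] -/
abbrev Link (L : ℕ) : Type := TorusSite 2 L × Fin 2

/-- `σˣ² = σᶻ² = 1` (and `σʸ² = 1`). Tasaki (2020) §2.1, eq. (2.1.8). [folklore] -/
theorem spinHalfPauli_mul_self (α : Fin 3) : spinHalfPauli α * spinHalfPauli α = 1 := by
  ext a b
  fin_cases α <;> fin_cases a <;> fin_cases b <;> simp [spinHalfPauli, Matrix.mul_apply]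

/-- The Pauli matrices are Hermitian. Tasaki (2020) §2.1, eq. (2.1.8). [folklore] -/
theorem spinHalfPauli_isHermitian (α : Fin 3) : (spinHalfPauli α).IsHermitian := by
  rw [IsHermitian]
  ext a b
  fin_cases α <;> fin_cases a <;> fin_cases b <;> simp [spinHalfPauli, conjTranspose_apply]

variable (L : ℕ) [NeZero L]

/-- `σˣ_b`: the Pauli matrix `σˣ` on the link `b`. Fradkin (2013) §9.6, eq. (9.42). [folklore] -/
def sigmaX (b : Link L) : Op (Link L) 2 := onSite b (spinHalfPauli 0)

/-- `σᶻ_b`: the Pauli matrix `σᶻ` on the link `b`. Fradkin (2013) §9.6, eq. (9.42). [folklore] -/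
def sigmaZ (b : Link L) : Op (Link L) 2 := onSite b (spinHalfPauli 2)

/-- `σˣ_b` is Hermitian. [folklore] -/
theorem sigmaX_isHermitian (b : Link L) : (sigmaX L b).IsHermitian :=
  onSite_isHermitian b (spinHalfPauli_isHermitian 0)

/-- `σᶻ_b` is Hermitian. [folklore] -/
theorem sigmaZ_isHermitian (b : Link L) : (sigmaZ L b).IsHermitian :=
  onSite_isHermitian b (spinHalfPauli_isHermitian 2)

/-- `(σˣ_b)² = 1`. [folklore] -/
theorem sigmaX_mul_self (b : Link L) : sigmaX L b * sigmaX L b = 1 := by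
  rw [sigmaX, onSite_mul, spinHalfPauli_mul_self, onSite_one']

/-- `(σᶻ_b)² = 1`. [folklore] -/
theorem sigmaZ_mul_self (b : Link L) : sigmaZ L b * sigmaZ L b = 1 := by
  rw [sigmaZ, onSite_mul, spinHalfPauli_mul_self, onSite_one']

/-! ### Plaquettes and stars -/

/-- The four links bounding the plaquette with lower-left corner `x`:
`(x,0), (x+e₀,1), (x+e₁,0), (x,1)`. Fradkin (2013) §9.6, eq. (9.42) (plaquette term). [folklore] -/
def plaquetteLinks (x : TorusSite 2 L) : Finset (Link L) :=
  {(x, 0), (x + Pi.single 0 1, 1), (x + Pi.single 1 1, 0), (x, 1)}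

/-- The four links touching the site `x`: `(x,0), (x,1), (x-e₀,0), (x-e₁,1)`.
Fradkin (2013) §9.6, eq. (9.44) (star / Gauss-law operator). [folklore] -/
def starLinks (x : TorusSite 2 L) : Finset (Link L) :=
  {(x, 0), (x, 1), (x - Pi.single 0 1, 0), (x - Pi.single 1 1, 1)}

/-- The plaquette (flux) operator `B_p = Π_{b ∈ ∂p} σᶻ_b`, as the product operator with `σᶻ` on
the plaquette links and `1` elsewhere. Fradkin (2013) §9.6, eq. (9.42); Kitaev (2003) §2.
[cite: Kitaev2003, §2] -/
def plaquetteOp (x : TorusSite 2 L) : Op (Link L) 2 :=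
  productOp fun b => if b ∈ plaquetteLinks L x then spinHalfPauli 2 else 1

/-- The star (gauge-generator) operator `A_x = Π_{b ∋ x} σˣ_b`. Fradkin (2013) §9.6, eq. (9.44);
Kitaev (2003) §2. [cite: Kitaev2003, §2] -/
def starOp (x : TorusSite 2 L) : Op (Link L) 2 :=
  productOp fun b => if b ∈ starLinks L x then spinHalfPauli 0 else 1

/-- `B_p² = 1`. Kitaev (2003) §2. [folklore] -/
theorem plaquetteOp_mul_self (x : TorusSite 2 L) : plaquetteOp L x * plaquetteOp L x = 1 := by
  rw [plaquetteOp, productOp_mul, ← productOp_one]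
  congr 1
  funext b
  split_ifs
  · exact spinHalfPauli_mul_self 2
  · exact mul_one 1

/-- `A_x² = 1`. Kitaev (2003) §2. [folklore] -/
theorem starOp_mul_self (x : TorusSite 2 L) : starOp L x * starOp L x = 1 := by
  rw [starOp, productOp_mul, ← productOp_one]
  congr 1
  funext b
  split_ifs
  · exact spinHalfPauli_mul_self 0
  · exact mul_one 1

/-- `B_p` is Hermitian. Kitaev (2003) §2. [folklore] -/
theorem plaquetteOp_isHermitian (x : TorusSite 2 L) : (plaquetteOp L x).IsHermitian := by
  rw [IsHermitian, plaquetteOp, productOp_conjTranspose]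
  congr 1
  funext b
  split_ifs
  · exact (spinHalfPauli_isHermitian 2).eq
  · exact conjTranspose_one

/-- `A_x` is Hermitian. Kitaev (2003) §2. [folklore] -/
theorem starOp_isHermitian (x : TorusSite 2 L) : (starOp L x).IsHermitian := by
  rw [IsHermitian, starOp, productOp_conjTranspose]
  congr 1
  funext b
  split_ifs
  · exact (spinHalfPauli_isHermitian 0).eq
  · exact conjTranspose_one

/-- For a Hermitian involution `B` (`B² = 1`), `½ (1 - B)` is a Hermitian idempotent — the
projector form of a toric-code term. Michalakis–Zwolak (2013) §2 (normal form). [folklore] -/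
theorem half_one_sub_isIdempotent {n : Type*} [Fintype n] [DecidableEq n] {B : Matrix n n ℂ}
    (hB : B * B = 1) : IsIdempotentElem ((1 / 2 : ℂ) • (1 - B)) := by
  rw [IsIdempotentElem, smul_mul_smul, Matrix.sub_mul, Matrix.mul_sub, Matrix.mul_sub, hB,
    Matrix.one_mul, Matrix.one_mul, Matrix.mul_one]
  have h : (1 : Matrix n n ℂ) - B - (B - 1) = (2 : ℂ) • (1 - B) := by
    rw [two_smul]
    abel
  rw [h, smul_smul]
  norm_num

/-- `½ (1 - B)` is Hermitian for Hermitian `B`. [folklore] -/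
theorem half_one_sub_isHermitian {n : Type*} {B : Matrix n n ℂ} [DecidableEq n]
    (hB : B.IsHermitian) : ((1 / 2 : ℂ) • (1 - B)).IsHermitian := by
  rw [IsHermitian, conjTranspose_smul, conjTranspose_sub, conjTranspose_one, hB.eq]
  congr 1
  simp

/-! ### The interactions -/

/-- **The toric code** on the links of `(ℤ/Lℤ)²` in commuting-projector form:
`Φ(∂p) = ½(1 - B_p)`, `Φ(star x) = ½(1 - A_x)`, `Φ = 0` on every other region (for `L ≤ 2`
plaquette and star link sets may coincide and their terms then add). Its Hamiltonian
`Σ_p ½(1 - B_p) + Σ_x ½(1 - A_x)` is Kitaev's `-Σ B_p - Σ A_x` up to the factor `½` and an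
additive constant. Kitaev (2003) §2; Fradkin (2013) §9.10 (the `g, λ → 0` limit of (9.76)).
[cite: Kitaev2003, §2] -/
def toricCode : Interaction (Link L) 2 := fun X =>
  (∑ x : TorusSite 2 L, if X = plaquetteLinks L x then (1 / 2 : ℂ) • (1 - plaquetteOp L x) else 0) +
    ∑ x : TorusSite 2 L, if X = starLinks L x then (1 / 2 : ℂ) • (1 - starOp L x) else 0

/-- The plaquette part `Φ(∂p) = ½(1 - B_p)` of the toric code alone. Kitaev (2003) §2. [folklore] -/
def toricPlaquettes : Interaction (Link L) 2 := fun X =>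
  ∑ x : TorusSite 2 L, if X = plaquetteLinks L x then (1 / 2 : ℂ) • (1 - plaquetteOp L x) else 0

/-- The star part `Φ(star x) = ½(1 - A_x)` of the toric code alone. Kitaev (2003) §2. [folklore] -/
def toricStars : Interaction (Link L) 2 := fun X =>
  ∑ x : TorusSite 2 L, if X = starLinks L x then (1 / 2 : ℂ) • (1 - starOp L x) else 0

/-- `toricCode = toricPlaquettes + toricStars` (definitional). [folklore] -/
theorem toricCode_eq : toricCode L = toricPlaquettes L + toricStars L := rfl

/-- **The single-link fields** `Φ({b}) = -Γ σˣ_b - μ σᶻ_b` (`0` on regions that are not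
singletons): the "electric" transverse field `Γ` of Hansson–Oganesyan–Sondhi (2004) §5.1 and the
unitary-gauge matter term `μ` of Fradkin (2013) §9.10, eq. (9.76). [cite: Fradkin2013, §9.10 eq. (9.76)] -/
def linkFields (Γ μ : ℝ) : Interaction (Link L) 2 := fun X =>
  ∑ b : Link L, if X = {b} then -(Γ : ℂ) • sigmaX L b - (μ : ℂ) • sigmaZ L b else 0

/-- **The `ℤ₂` gauge–Higgs model in unitary gauge** (toric code in fields):
`K • (plaquette projectors) + J • (star projectors) + linkFields Γ μ`, i.e. the Hamiltonian
`K Σ_p ½(1 - B_p) + J Σ_x ½(1 - A_x) - Γ Σ_b σˣ_b - μ Σ_b σᶻ_b`. Fradkin (2013) §9.10, eq. (9.76)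
is `K = 2/g`, `J = 2/λ`, `Γ = g`, `μ = λ` (up to the additive constant `-(K + J) L² / 2`);
Hansson–Oganesyan–Sondhi (2004) §5.1 is `μ = 0`. [cite: Fradkin2013, §9.10 eq. (9.76)] -/
def z2GaugeHiggs (K J Γ μ : ℝ) : Interaction (Link L) 2 :=
  (K : ℂ) • toricPlaquettes L + (J : ℂ) • toricStars L + linkFields L Γ μ

/-- At `K = J = 1`, `Γ = μ = 0` the gauge–Higgs interaction is the toric code. Fradkin (2013)
§9.10 (after eq. (9.77)). [folklore] -/
theorem z2GaugeHiggs_one_one_zero_zero : z2GaugeHiggs L 1 1 0 0 = toricCode L := by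
  funext X
  simp only [z2GaugeHiggs, toricCode_eq, Interaction.add_apply, Complex.ofReal_one, one_smul,
    linkFields, Complex.ofReal_zero, neg_zero, zero_smul, sub_zero, ite_self,
    Finset.sum_const_zero, add_zero]

/-! ### Supports -/

/-- A product operator whose factors are `1` off `X` is supported on `X` (private copy of
`isSupportedOn_productOp_of_eq_one` of `InfiniteVolumeLSMBondProofs.lean`, not imported to keep the
dependencies of this file small). Bratteli–Robinson II §6.2.1. [folklore] -/
private theorem isSupportedOn_productOp_of_eq_one' {Λ : Type*} [Fintype Λ] [DecidableEq Λ]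
    {q : ℕ} (X : Finset Λ) {u : Λ → Matrix (Fin q) (Fin q) ℂ} (hu : ∀ y, y ∉ X → u y = 1) :
    IsSupportedOn (productOp u) X := by
  refine ⟨productOp fun x : ↥X => u x, ?_⟩
  ext σ τ
  rw [productOp_apply, localOp_apply, productOp_apply,
    ← Finset.prod_filter_mul_prod_filter_not univ (fun y : Λ => y ∈ X)]
  have h1 : (univ.filter fun y : Λ => y ∈ X) = X := by
    ext y; simp
  have h2 : (∏ y ∈ univ.filter (fun y : Λ => ¬ y ∈ X), u y (σ y) (τ y)) =
      ∏ y ∈ univ.filter (fun y : Λ => ¬ y ∈ X), (if σ y = τ y then 1 else 0) := by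
    refine Finset.prod_congr rfl fun y hy => ?_
    rw [hu y (Finset.mem_filter.1 hy).2, one_apply]
  rw [h2, Finset.prod_boole, h1, Finset.prod_subtype X (p := fun y => y ∈ X) (fun _ => Iff.rfl)]
  by_cases hc : ∀ y, y ∉ X → σ y = τ y
  · rw [if_pos hc, if_pos, mul_one]
    intro y hy
    exact hc y (Finset.mem_filter.1 hy).2
  · rw [if_neg hc, if_neg, mul_zero]
    intro h
    exact hc fun y hy => h y (Finset.mem_filter.2 ⟨mem_univ _, hy⟩)

/-- `B_p ∈ 𝔄_{∂p}`: the plaquette operator is supported on the plaquette links.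
Kitaev (2003) §2. [folklore] -/
theorem isSupportedOn_plaquetteOp (x : TorusSite 2 L) :
    IsSupportedOn (plaquetteOp L x) (plaquetteLinks L x) :=
  isSupportedOn_productOp_of_eq_one' _ fun _ hy => if_neg hy

/-- `A_x ∈ 𝔄_{star x}`: the star operator is supported on the star links. Kitaev (2003) §2.
[folklore] -/
theorem isSupportedOn_starOp (x : TorusSite 2 L) :
    IsSupportedOn (starOp L x) (starLinks L x) :=
  isSupportedOn_productOp_of_eq_one' _ fun _ hy => if_neg hy

/-- `σˣ_b`, `σᶻ_b` are supported on `{b}`. [folklore] -/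
theorem isSupportedOn_sigma (b : Link L) :
    IsSupportedOn (sigmaX L b) {b} ∧ IsSupportedOn (sigmaZ L b) {b} :=
  ⟨isSupportedOn_onSite_holds b (spinHalfPauli 0), isSupportedOn_onSite_holds b (spinHalfPauli 2)⟩

/-! ### Locality of the interactions -/

variable {L}

/-- Differences of supported operators are supported. Bratteli–Robinson II §6.2.1. [folklore] -/
theorem isSupportedOn_sub {A B : Op (Link L) 2} {X : Finset (Link L)} (hA : IsSupportedOn A X)
    (hB : IsSupportedOn B X) : IsSupportedOn (A - B) X := by
  rw [sub_eq_add_neg, ← neg_one_smul ℂ B]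
  exact hA.add (hB.smul (-1))

/-- The projector term `½(1 - B)` inherits the support of `B`. [folklore] -/
theorem isSupportedOn_half_one_sub {B : Op (Link L) 2} {X : Finset (Link L)}
    (hB : IsSupportedOn B X) : IsSupportedOn ((1 / 2 : ℂ) • (1 - B)) X :=
  (isSupportedOn_sub (IsSupportedOn.one X) hB).smul _

variable (L)

/-- **The toric code is a local interaction**: every term is supported on its region and
Hermitian. Kitaev (2003) §2; Michalakis–Zwolak (2013) §2. [folklore] -/
theorem toricCode_isLocal : (toricCode L).IsLocal := by
  intro X
  constructor
  · refine (IsSupportedOn.sum _ fun x _ => ?_).add (IsSupportedOn.sum _ fun x _ => ?_)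
    · by_cases h : X = plaquetteLinks L x
      · rw [if_pos h, h]
        exact isSupportedOn_half_one_sub (isSupportedOn_plaquetteOp L x)
      · rw [if_neg h]
        exact IsSupportedOn.zero X
    · by_cases h : X = starLinks L x
      · rw [if_pos h, h]
        exact isSupportedOn_half_one_sub (isSupportedOn_starOp L x)
      · rw [if_neg h]
        exact IsSupportedOn.zero X
  · change ((∑ x : TorusSite 2 L, if X = plaquetteLinks L x then (1 / 2 : ℂ) • (1 - plaquetteOp L x)
        else 0) + ∑ x : TorusSite 2 L, if X = starLinks L x then (1 / 2 : ℂ) • (1 - starOp L x)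
        else 0).IsHermitian
    refine IsHermitian.add ?_ ?_
    · rw [IsHermitian, conjTranspose_sum]
      refine Finset.sum_congr rfl fun x _ => ?_
      split_ifs
      · exact (half_one_sub_isHermitian (plaquetteOp_isHermitian L x)).eq
      · exact conjTranspose_zero
    · rw [IsHermitian, conjTranspose_sum]
      refine Finset.sum_congr rfl fun x _ => ?_
      split_ifs
      · exact (half_one_sub_isHermitian (starOp_isHermitian L x)).eq
      · exact conjTranspose_zero

/-- **The link fields are a local interaction.** [folklore] -/
theorem linkFields_isLocal (Γ μ : ℝ) : (linkFields L Γ μ).IsLocal := by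
  intro X
  constructor
  · refine IsSupportedOn.sum _ fun b _ => ?_
    by_cases h : X = {b}
    · rw [if_pos h, h]
      exact isSupportedOn_sub ((isSupportedOn_sigma L b).1.smul _) ((isSupportedOn_sigma L b).2.smul _)
    · rw [if_neg h]
      exact IsSupportedOn.zero X
  · change (∑ b : Link L, if X = {b} then -(Γ : ℂ) • sigmaX L b - (μ : ℂ) • sigmaZ L b
        else 0).IsHermitian
    rw [IsHermitian, conjTranspose_sum]
    refine Finset.sum_congr rfl fun b _ => ?_
    split_ifs
    · rw [conjTranspose_sub, conjTranspose_smul, conjTranspose_smul, (sigmaX_isHermitian L b).eq,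
        (sigmaZ_isHermitian L b).eq]
      simp only [star_neg, Complex.star_def, Complex.conj_ofReal]
    · exact conjTranspose_zero

end Z2GaugeHiggs

end Literature.MathematicalPhysics.QuantumLattice
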